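import Literature.NumberTheory.Automorphic.Liu2021.LemD1BinaryIsotropyOfPlace
import Literature.NumberTheory.GelbartRogawski1991.UnitaryDualPairThetaKernelCM
import Literature.NumberTheory.GelbartRogawski1991.LocalDoubledUnitaryLagrangians
import Literature.NumberTheory.QuadraticForms.HilbertReciprocityFiniteness
import Literature.NumberTheory.QuadraticForms.HilbertSymbolRegular
import HarnessLib

/-!
# The binary norm-type form `t₀·N(x₀) + t₁·N(x₁)` on `E_v²` is anisotropic when `(d, −t₀t₁)_v = −1` (raw-coordinate corollary of
# ★ `LemD1OfPlace.not_isIsotropic_standingData_iff_hilbertSymbol_eq_neg_one`), and its CM reading for the plane `T₁ ⊕ αT₁`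

Topic `NumberTheory/Automorphic/Liu2021`; namespace `Literature.NumberTheory.Automorphic.Liu2021.LemD1OfPlace`.  KERNEL ONLY: theorems,
no definition, no named fact, no `sorry`; nothing of [Liu2021] is asserted.

* `eq_zero_of_sum_mul_conjLocal_eq_zero_of_hilbertSymbol_eq_neg_one` — for a quadratic extension `E/F` of number fields (`c δ = −δ ≠ 0`,
  `δ² = d`), a finite place `v` of `F` and `t₀ t₁ ≠ 0` in `F` with `(d, −t₀t₁)_{F_v} = −1`: if
  `t₀ · x₀ (c⊗1)x₀ + t₁ · x₁ (c⊗1)x₁ = 0` in `E_v = E ⊗_F F_v` then `x₀ = x₁ = 0` — the raw-coordinate form of «`V_v` anisotropic» in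
  [Liu2021, App. D Lemma D.1 (4)] (`n = 2`), read through ★ `form_self_eq_toLocalRing_sum` and ★ `toLocalRing_algebraNorm`.
* `hilbertSymbol_neg_mul_mul_sq_eq` — the symbol book-keeping `(d, −(t · (α t)))_v = (−α⁻¹, d)_v`.
* `eq_zero_of_sum_mul_conjLocal_eq_zero_of_hilbertSymbol_cm` — the CM reading: `L` CM, `v` a finite place of `L⁺`,
  `(−α⁻¹, δ²)_v = −1` (`δ = imagUnit L`) ⇒ `t·x₁x̄₁ + (αt)·x₂x̄₂ = 0 → x₁ = x₂ = 0` on `LocalRing L v` — the anisotropy input of the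
  anisotropic-plane arguments on `T₁ ⊕ αT₁` (cell hodgecm-mathlib, line LD2 (Z)/(AN)).
* `anisotropic_hermForm_gramS_finSum_of_hilbertSymbol_eq_neg_one` (+ `_cm`) — the same in the `hS` currency of
  ★ `LocalDoubledAnisotropicFactorisation` (`∀ x, hermForm (conjLocal E c v) (gramS F E v (1+1) T) x x = 0 → x = 0` for
  `T = finSum 1 1 T₁ (α • T₁)`), binders `hT₁d`/`α`/`hTT'`/`hclass`/`hT` as in the plane files (`rankOne_theta_anisotropicPlane_dichotomy`).

## References
* [Liu2021] Y. Liu, Camb. J. Math. 9 (2021) = arXiv:2102.11518, App. D Lemma D.1 (4) (l. 5235).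
* [Omeara1963] O. T. O'Meara, *Introduction to Quadratic Forms* (1963), §63B.
-/

set_option autoImplicit false

noncomputable section

open scoped Matrix
open NumberField IsDedekindDomain
open Literature.NumberTheory.Automorphic.UnitaryGroup
open Literature.NumberTheory.QuadraticForms
open Literature.RepresentationTheory.Liu2021 (OscillatorStandingData)

namespace Literature.NumberTheory.Automorphic.Liu2021.LemD1OfPlace

section General

variable {F : Type} (E : Type) [Field F] [NumberField F] [Field E] [NumberField E] [Algebra F E]
  [Algebra.IsQuadraticExtension F E] (v : HeightOneSpectrum (𝓞 F)) (c : E ≃ₐ[F] E) {δ : E}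

omit [NumberField F] [NumberField E] [Algebra.IsQuadraticExtension F E] in
/-- the diagonal matrix `diag(t) ⊗ 1` with entries from `F` is `c`-hermitian. [folklore] -/
private theorem diagonal_map_hermitian (t : Fin 2 → F) :
    ((((Matrix.diagonal t).map (algebraMap F E)).map c)ᵀ) = (Matrix.diagonal t).map (algebraMap F E) := by
  rw [Matrix.map_map]
  have hc : (c : E → E) ∘ (algebraMap F E) = algebraMap F E := funext fun x => c.commutes x
  rw [hc, Matrix.diagonal_map (map_zero _), Matrix.diagonal_transpose]

omit [NumberField F] [NumberField E] [Algebra.IsQuadraticExtension F E] in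
/-- `det (diag(t₀, t₁) ⊗ 1) ≠ 0` for `t₀ t₁ ≠ 0`. [folklore] -/
private theorem diagonal_map_det_ne_zero (t : Fin 2 → F) (ht : ∀ i, t i ≠ 0) :
    ((Matrix.diagonal t).map (algebraMap F E)).det ≠ 0 := by
  rw [Matrix.diagonal_map (map_zero _), Matrix.det_diagonal]
  exact Finset.prod_ne_zero_iff.2 fun i _ => (map_ne_zero _).2 (ht i)

/-- **Anisotropy of the binary norm-type form from the Hilbert symbol** ([Liu2021, Lem. D.1 (4)]'s «`V` anisotropic» at `n = 2`,
raw coordinates): for `t₀ t₁ ∈ F^×` with `(d, −t₀t₁)_{F_v} = −1` (`δ² = d`, `c δ = −δ`), the relation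
`t₀ · x₀ (c⊗1)x₀ + t₁ · x₁ (c⊗1)x₁ = 0` in `E_v` forces `x₀ = x₁ = 0`.
[cite: Omeara1963, §63B] [cite: Liu2021, App. D Lemma D.1 (4) (l. 5235)] -/
theorem eq_zero_of_sum_mul_conjLocal_eq_zero_of_hilbertSymbol_eq_neg_one (hcδ : c δ = -δ) (hδ : δ ≠ 0)
    {d : F} (hd : δ * δ = algebraMap F E d) (t : Fin 2 → F) (ht : ∀ i, t i ≠ 0)
    (h : hilbertSymbol (v.adicCompletion F) (algebraMap F _ d) (algebraMap F _ (-(t 0 * t 1))) = -1)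
    (x : Fin 2 → LocalRing E v)
    (hx : algebraMap F (LocalRing E v) (t 0) * (x 0 * conjLocal E c v (x 0)) +
      algebraMap F (LocalRing E v) (t 1) * (x 1 * conjLocal E c v (x 1)) = 0) :
    x = 0 := by
  set J : Matrix (Fin 2) (Fin 2) E := (Matrix.diagonal t).map (algebraMap F E) with hJ
  have hJh : (J.map c)ᵀ = J := diagonal_map_hermitian E c t
  have hJdet : J.det ≠ 0 := diagonal_map_det_ne_zero E t ht
  have han := (not_isIsotropic_standingData_iff_hilbertSymbol_eq_neg_one E v c hcδ hδ t hJ hJh hJdet hd ht).2 h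
  by_contra hx0
  apply han
  refine ⟨x, hx0, ?_⟩
  rw [form_self_eq_toLocalRing_sum E v c hcδ hδ t hJ hJh hJdet, Fin.sum_univ_two, map_add, map_mul, map_mul,
    toLocalRing_algebraNorm E v c hcδ hδ, toLocalRing_algebraNorm E v c hcδ hδ, ← algebraMap_localRing_eq,
    ← IsScalarTower.algebraMap_apply, ← IsScalarTower.algebraMap_apply]
  exact hx

/-- **symbol book-keeping for the plane `t ⊕ αt`**: `(d, −(t · αt))_v = (−α⁻¹, d)_v` (`−t·αt = (−α⁻¹)·(αt)²`, square-class
invariance and symmetry of the Hilbert symbol). [cite: Omeara1963, §63B] -/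
theorem hilbertSymbol_neg_mul_mul_sq_eq {K : Type*} [Field K] (d t α : K) (ht : t ≠ 0) (hα : α ≠ 0) :
    hilbertSymbol K d (-(t * (α * t))) = hilbertSymbol K (-α⁻¹) d := by
  have h1 : -(t * (α * t)) = -α⁻¹ * (α * t) ^ 2 := by field_simp
  rw [h1, hilbertSymbol_mul_sq_right _ _ (mul_ne_zero hα ht), hilbertSymbol_comm]

end General

section CM

open Literature.NumberTheory.GelbartRogawski1991.UnitaryDualPair

variable (L : Type) [Field L] [NumberField L] [IsCMField L] (v : HeightOneSpectrum (𝓞 (maximalRealSubfield L)))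

/-- **CM reading — the anisotropy input for the plane `T₁ ⊕ αT₁` at a place with `(−α⁻¹, δ²)_v = −1`**: for `L` CM with
`δ = imagUnit L` (`cc δ = −δ`, `δ² = imagUnitSq L ∈ L⁺`), `t ∈ L⁺^×`, `α ∈ L⁺^×` and a finite place `v` of `L⁺` with
`hilbertSymbol L⁺_v (−α⁻¹) (δ²) = −1`: `t · x₁x̄₁ + (αt) · x₂x̄₂ = 0` in `LocalRing L v = L ⊗_{L⁺} L⁺_v` forces `x₁ = x₂ = 0`.
[cite: Omeara1963, §63B] [cite: Liu2021, App. D Lemma D.1 (4) (l. 5235)] -/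
theorem eq_zero_of_sum_mul_conjLocal_eq_zero_of_hilbertSymbol_cm (t : maximalRealSubfield L) (ht : t ≠ 0)
    (α : (maximalRealSubfield L)ˣ)
    (hclass : hilbertSymbol (v.adicCompletion (maximalRealSubfield L))
      ((-(α : maximalRealSubfield L)⁻¹ : maximalRealSubfield L) : v.adicCompletion (maximalRealSubfield L))
      ((imagUnitSq L : maximalRealSubfield L) : v.adicCompletion (maximalRealSubfield L)) = -1)
    (x₁ x₂ : LocalRing L v)
    (hx : algebraMap (maximalRealSubfield L) (LocalRing L v) t * (x₁ * conjLocal L (IsCMField.complexConj L) v x₁) +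
      algebraMap (maximalRealSubfield L) (LocalRing L v) ((α : maximalRealSubfield L) * t) *
        (x₂ * conjLocal L (IsCMField.complexConj L) v x₂) = 0) :
    x₁ = 0 ∧ x₂ = 0 := by
  have hα : ((α : maximalRealSubfield L) : v.adicCompletion (maximalRealSubfield L)) ≠ 0 :=
    (map_ne_zero (algebraMap (maximalRealSubfield L) _)).2 α.ne_zero
  have htv : ((t : maximalRealSubfield L) : v.adicCompletion (maximalRealSubfield L)) ≠ 0 :=
    (map_ne_zero (algebraMap (maximalRealSubfield L) _)).2 ht
  have hsym : hilbertSymbol (v.adicCompletion (maximalRealSubfield L))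
      (algebraMap (maximalRealSubfield L) _ (imagUnitSq L))
      (algebraMap (maximalRealSubfield L) _ (-(![t, (α : maximalRealSubfield L) * t] 0 * ![t, (α : maximalRealSubfield L) * t] 1))) = -1 := by
    simp only [Matrix.cons_val_zero, Matrix.cons_val_one]
    rw [map_neg, map_mul, map_mul]
    change hilbertSymbol _ ((imagUnitSq L : maximalRealSubfield L) : v.adicCompletion (maximalRealSubfield L))
      (-((t : v.adicCompletion (maximalRealSubfield L)) * ((α : maximalRealSubfield L) * t))) = -1
    rw [hilbertSymbol_neg_mul_mul_sq_eq _ _ _ htv hα, ← hclass]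
    congr 1
    change _ = algebraMap (maximalRealSubfield L) (v.adicCompletion (maximalRealSubfield L)) (-(α : maximalRealSubfield L)⁻¹)
    rw [map_neg, map_inv₀]
    rfl
  have h := eq_zero_of_sum_mul_conjLocal_eq_zero_of_hilbertSymbol_eq_neg_one L v (IsCMField.complexConj L)
    (complexConj_imagUnit L) (imagUnit_ne_zero L) (imagUnit_mul_self L) ![t, (α : maximalRealSubfield L) * t]
    (fun i => by fin_cases i <;> simp [ht, α.ne_zero]) hsym ![x₁, x₂]
    (by simpa only [Matrix.cons_val_zero, Matrix.cons_val_one] using hx)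
  exact ⟨by simpa using congr_fun h 0, by simpa using congr_fun h 1⟩

end CM


section HSCurrency

open Literature.NumberTheory.GelbartRogawski1991.UnitaryDualPair.LocalSplitting (gramS)

variable {F : Type} (E : Type) [Field F] [NumberField F] [Field E] [NumberField E] [Algebra F E]
  [Algebra.IsQuadraticExtension F E] (v : HeightOneSpectrum (𝓞 F)) (c : E ≃ₐ[F] E) {δ : E}

omit [NumberField F] in
/-- `T₁ ⊕ T₂ = diag(T₁ 0 0, T₂ 0 0)` for two `1 × 1` blocks (`UnitaryGroup.finSum 1 1`, `Fin (1 + 1) = Fin 2`; the block-sum bookkeeping of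
★ `gram_diagonal_units_TW_eq_finSum`). [cite: GelbartRogawski1991, §3.1 p. 454] -/
theorem finSum_one_one_eq_diagonal (T₁ T₂ : Matrix (Fin 1) (Fin 1) F) :
    UnitaryGroup.finSum 1 1 T₁ T₂ = Matrix.diagonal ![T₁ 0 0, T₂ 0 0] := by
  refine Matrix.ext fun i j => ?_
  fin_cases i <;> fin_cases j <;>
    simp [UnitaryGroup.finSum, Matrix.fromBlocks, Matrix.diagonal, finSumFinEquiv, Fin.addCases, Matrix.of_apply]

omit [Algebra.IsQuadraticExtension F E] in
/-- the hermitian form of a DIAGONAL Gram matrix `diag(t) ⊗ 1` on `E_v^{1+1}` is `Σ_i t_i · x_i (c⊗1)x_i` (the `UnitaryGroup.hermForm`∕`gramS`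
twin of ★ `form_self_eq_toLocalRing_sum`). [cite: Liu2021, App. D §D.1 (l. 5213–5215)] -/
theorem hermForm_gramS_diagonal_self (t : Fin (1 + 1) → F) (x : Fin (1 + 1) → LocalRing E v) :
    UnitaryGroup.hermForm (conjLocal E c v) (gramS F E v (1 + 1) (Matrix.diagonal t)) x x =
      algebraMap F (LocalRing E v) (t 0) * (x 0 * conjLocal E c v (x 0)) +
        algebraMap F (LocalRing E v) (t 1) * (x 1 * conjLocal E c v (x 1)) := by
  unfold UnitaryGroup.hermForm
  rw [show gramS F E v (1 + 1) (Matrix.diagonal t) =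
      Matrix.diagonal (fun i => toLocalRing E v (algebraMap F (v.adicCompletion F) (t i))) from by
    dsimp only [gramS]
    rw [Matrix.diagonal_map (map_zero _), Matrix.diagonal_map (map_zero _)]]
  rw [dotProduct, Fin.sum_univ_two]
  simp only [Function.comp_apply, Matrix.mulVec_diagonal]
  rw [← algebraMap_localRing_eq, ← IsScalarTower.algebraMap_apply, ← IsScalarTower.algebraMap_apply]
  ring

/-- **Anisotropy of the plane `T₁ ⊕ αT₁` over `E ⊗ F_v` from `(−α⁻¹, d)_v = −1`, in the `hS` currency of the doubled-group files**
(★ `LocalDoubledAnisotropicFactorisation`, ★ `rankOne_theta_anisotropicPlane_dichotomy`): for `T = T₁ ⊕ T₂`, `T₂ = α • T₁`, `det T₁` a unit,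
`∀ x, UnitaryGroup.hermForm (c⊗1) (T ⊗ 1) x x = 0 → x = 0`. [cite: Omeara1963, §63B] [cite: Liu2021, App. D Lemma D.1 (4) (l. 5235)] -/
theorem anisotropic_hermForm_gramS_finSum_of_hilbertSymbol_eq_neg_one (hcδ : c δ = -δ) (hδ : δ ≠ 0)
    {d : F} (hd : δ * δ = algebraMap F E d)
    {T₁ T₂ : Matrix (Fin 1) (Fin 1) F} (hT₁d : IsUnit T₁.det) (α : Fˣ) (hTT' : T₂ = (α : F) • T₁)
    (hclass : hilbertSymbol (v.adicCompletion F) ((-(α : F)⁻¹ : F) : v.adicCompletion F) ((d : F) : v.adicCompletion F) = -1)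
    {T : Matrix (Fin (1 + 1)) (Fin (1 + 1)) F} (hT : T = UnitaryGroup.finSum 1 1 T₁ T₂) :
    ∀ x : Fin (1 + 1) → LocalRing E v,
      UnitaryGroup.hermForm (conjLocal E c v) (gramS F E v (1 + 1) T) x x = 0 → x = 0 := by
  intro x hx
  have ht₁ : T₁ 0 0 ≠ 0 := by rw [← Matrix.det_fin_one T₁]; exact hT₁d.ne_zero
  have hT' : T = Matrix.diagonal ![T₁ 0 0, (α : F) * T₁ 0 0] := by
    rw [hT, finSum_one_one_eq_diagonal, hTT', Matrix.smul_apply, smul_eq_mul]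
  rw [hT', hermForm_gramS_diagonal_self] at hx
  have hαv : ((α : F) : v.adicCompletion F) ≠ 0 := (map_ne_zero (algebraMap F _)).2 α.ne_zero
  have htv : ((T₁ 0 0 : F) : v.adicCompletion F) ≠ 0 := (map_ne_zero (algebraMap F _)).2 ht₁
  refine eq_zero_of_sum_mul_conjLocal_eq_zero_of_hilbertSymbol_eq_neg_one E v c hcδ hδ hd ![T₁ 0 0, (α : F) * T₁ 0 0]
    (fun i => by fin_cases i <;> simp [ht₁, α.ne_zero]) ?_ x (by simpa only [Matrix.cons_val_zero, Matrix.cons_val_one] using hx)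
  simp only [Matrix.cons_val_zero, Matrix.cons_val_one]
  rw [map_neg, map_mul, map_mul]
  change hilbertSymbol _ ((d : F) : v.adicCompletion F)
    (-(((T₁ 0 0 : F) : v.adicCompletion F) * (((α : F) : v.adicCompletion F) * ((T₁ 0 0 : F) : v.adicCompletion F)))) = -1
  rw [hilbertSymbol_neg_mul_mul_sq_eq _ _ _ htv hαv, ← hclass]
  congr 1
  change _ = algebraMap F (v.adicCompletion F) (-(α : F)⁻¹)
  rw [map_neg, map_inv₀]
  rfl

end HSCurrency

section HSCurrencyCM

open Literature.NumberTheory.GelbartRogawski1991.UnitaryDualPair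
open Literature.NumberTheory.GelbartRogawski1991.UnitaryDualPair.LocalSplitting (gramS)

variable (L : Type) [Field L] [NumberField L] [IsCMField L] (v : HeightOneSpectrum (𝓞 (maximalRealSubfield L)))

/-- **CM reading in the `hS` currency** — for `L` CM (`δ = imagUnit L`, `δ² = imagUnitSq L`), a finite place `v` of `L⁺`, the plane
`T = T₁ ⊕ T₂` with `T₂ = α • T₁`, `det T₁` a unit and `(−α⁻¹, δ²)_v = −1`: `T ⊗ 1` is anisotropic over `LocalRing L v = L ⊗_{L⁺} L⁺_v`
(binders `hT₁d α hTT' hclass hT` verbatim as in the anisotropic-plane statements). [cite: Omeara1963, §63B] [cite: Liu2021, App. D Lemma D.1 (4) (l. 5235)] -/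
theorem anisotropic_hermForm_gramS_finSum_of_hilbertSymbol_cm
    {T₁ T₂ : Matrix (Fin 1) (Fin 1) (maximalRealSubfield L)} (hT₁d : IsUnit T₁.det) (α : (maximalRealSubfield L)ˣ)
    (hTT' : T₂ = (α : maximalRealSubfield L) • T₁)
    (hclass : hilbertSymbol (v.adicCompletion (maximalRealSubfield L))
      ((-(α : maximalRealSubfield L)⁻¹ : maximalRealSubfield L) : v.adicCompletion (maximalRealSubfield L))
      ((imagUnitSq L : maximalRealSubfield L) : v.adicCompletion (maximalRealSubfield L)) = -1)
    {T : Matrix (Fin (1 + 1)) (Fin (1 + 1)) (maximalRealSubfield L)} (hT : T = UnitaryGroup.finSum 1 1 T₁ T₂) :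
    ∀ x : Fin (1 + 1) → LocalRing L v,
      UnitaryGroup.hermForm (conjLocal L (IsCMField.complexConj L) v)
        (gramS (maximalRealSubfield L) L v (1 + 1) T) x x = 0 → x = 0 :=
  anisotropic_hermForm_gramS_finSum_of_hilbertSymbol_eq_neg_one L v (IsCMField.complexConj L) (complexConj_imagUnit L)
    (imagUnit_ne_zero L) (imagUnit_mul_self L) hT₁d α hTT' hclass hT

end HSCurrencyCM

end Literature.NumberTheory.Automorphic.Liu2021.LemD1OfPlace

end
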